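import Summits.RiemannHypothesis.RiemannHypothesis.Theorems.Splittings.LiIncrMeanSquare
import Summits.RiemannHypothesis.RiemannHypothesis.Theorems.Splittings.LiSignPatterns
import Literature.NumberTheory.LFunctions.EquivalentsKeiperLiProofs
import HarnessLib

/-!
# T-Li3 REDUCED to one typed block law (li-bridge g6 §5; one Prop def `TLi3.LiIncrBlockLaw` in hypothesis position only)

Cell rh-split, seat rh-split-li-bridge g6 (brief sha16 f79c5f09d8bcb036), card `run/shared/lean/pub/rh-split/cards/SPLIT-li-bridge.md` §13;
§5 of `HOME/rh-split-li-bridge/SketchG6.lean` sha16 ed64da7a8eb46ca1 (referee rh-split-ref g3 REPLAY PASS + LABELS 2026-08-27T05:44:52Z,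
card block 06:17:36Z with 13.5 «SOUND ON PAPER»; lead rh-split-lead g3 RULING #26 (xi)(b): «`LiIncrBlockLaw` a Prop in HYPOTHESIS position
only, with a PROSE source line, no cite tag»); filed by rh-split-typer-2 g4 on top of `LiIncrMeanSquare.lean` (§4).  DELTA vs the scratch:
`liIncr n` spelled out as `keiperLiCoeff (n+1) − keiperLiCoeff n` (8 sites) and the source line added to the def's docstring; blocks
otherwise verbatim; namespace `…Splittings.LiIncrBlockLaw` with the scratch's sub-namespace `TLi3`.

* `TLi3.card_neg_mul_sq_le` — Chebyshev count on a block (pure);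
* `TLi3.LiIncrBlockLaw c K N` — the typed OPEN block law on the dyadic block `[N, 2N)` (NOT in print; hypothesis position only);
* `TLi3.card_liIncr_neg_block_le` — block law ⟹ `#{n ∈ [N,2N) : Δ_n < 0} ≤ (K/c²)·N/log N` (engine `MeanSquare.sum_sq_le'`);
* `TLi3.densityZero_of_dyadic`, `TLi3.densityZero_liIncr_neg_of_blockLaw` — dyadic ⟹ natural density zero (pure bookkeeping);
* `TLi3.rh_iff_almostAllLiMonotone_of_blockLaw : (RH → ∃ c K N₀, block law for N ≥ N₀) → (RH ↔ λ_n ≤ λ_{n+1} off a density-zero set)`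
  — T-Li3 REDUCED; converse = the tree's T-Li2 `LiExtremalLayer.rh_of_liIncr_nonneg_off_densityZero` (p498482).

LABELS (referee g3): KERNEL REDUCTION CONDITIONAL-on `LiIncrBlockLaw` = OPEN typed target with a paper proof (card 13.5), never «in print»;
CANDIDATES C12: T-Li3 REDUCED; class (li, bridge) UNCHANGED (barrier note).

HONEST LABEL: «SPLITTING SEARCH over kernel-typed RH-EQUIVALENCES; a splitting A ∧ B ⟹ RH is CONDITIONAL bookkeeping unless A and B are
both proved; nothing here bears on the truth of RH.»
-/

set_option linter.dupNamespace false

noncomputable section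

open Complex Filter Topology Finset
open scoped Real ComplexConjugate

namespace Summit.RiemannHypothesis.RiemannHypothesis.Theorems.Splittings.LiIncrBlockLaw

open Literature.NumberTheory.LFunctions
open Summit.RiemannHypothesis.RiemannHypothesis.Theorems.Splittings
open Summit.RiemannHypothesis.RiemannHypothesis.Theorems.Splittings.LiIncrMeanSquare

/-! ## §5 T-Li3 REDUCED (kernel): Chebyshev on dyadic blocks + the ENGINE ⟹
«density-zero monotonicity exceptions» from ONE typed block law; with tree T-Li2 (p498482) the
equivalence `RH ↔ AlmostAllLiMonotone` then hangs on `RH → LiIncrBlockLaw` alone. -/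

namespace TLi3

open MeanSquare

/-- Chebyshev count on a block: if `Δ = P + F` on `[N, N+M)` with `P ≥ m > 0` there, then
`#{n ∈ [N, N+M) : Δ n < 0} · m² ≤ Σ_{n ∈ [N, N+M)} F(n)²`. (Pure.) -/
theorem card_neg_mul_sq_le {N M : ℕ} {Δ P F : ℕ → ℝ} {m : ℝ} (hm : 0 < m)
    (hdec : ∀ n ∈ Finset.Ico N (N + M), Δ n = P n + F n)
    (hP : ∀ n ∈ Finset.Ico N (N + M), m ≤ P n) :
    ((((Finset.Ico N (N + M)).filter (fun n ↦ Δ n < 0)).card : ℕ) : ℝ) * m ^ 2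
      ≤ ∑ n ∈ Finset.Ico N (N + M), F n ^ 2 := by
  classical
  calc ((((Finset.Ico N (N + M)).filter (fun n ↦ Δ n < 0)).card : ℕ) : ℝ) * m ^ 2
      = ∑ _n ∈ (Finset.Ico N (N + M)).filter (fun n ↦ Δ n < 0), m ^ 2 := by
        rw [Finset.sum_const, nsmul_eq_mul]
    _ ≤ ∑ n ∈ (Finset.Ico N (N + M)).filter (fun n ↦ Δ n < 0), F n ^ 2 := by
        refine Finset.sum_le_sum fun n hn ↦ ?_
        obtain ⟨hn1, hn2⟩ := Finset.mem_filter.1 hn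
        have h1 := hdec n hn1
        have h2 := hP n hn1
        have hF : F n ≤ -m := by linarith
        nlinarith
    _ ≤ ∑ n ∈ Finset.Ico N (N + M), F n ^ 2 :=
        Finset.sum_le_sum_of_subset_of_nonneg (Finset.filter_subset _ _) fun n _ _ ↦ sq_nonneg _

/-- **The one typed analytic input of T-Li3** (to be proved under RH; paper proof = explicit formula
for `Δ_n` split at height `Y ≈ √(4N)`, high part `≥ (½ − A/4 − ε) log N − B` pointwise from the
Backlund `S(t)` bound, low part = the finite trigonometric sum with `a_γ = 4m sin(θ_γ/2) ≈ 2/γ`,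
`θ_γ = 2 arctan(1/(2γ))`, and the bilinear weight bounded through LOCAL ZERO DENSITY).
On the dyadic block `n ∈ [N, 2N)`:  `Δ_n = P(n) + Σ_{j ∈ s} a_j sin((n+½)θ_j)`, `θ_j ∈ (0, π/2]`,
`P(n) ≥ c·log N`, and `Σ_{j,k} |a_j a_k| D_N(θ_j − θ_k) ≤ K·N·log N`.
Source: a TYPED OPEN TARGET of cell rh-split (li, bridge) g6, card `SPLIT-li-bridge.md` §13.5 (a paper proof under RH is
given there); it is NOT a result in print and is used below in HYPOTHESIS position only. -/
def LiIncrBlockLaw (c K : ℝ) (N : ℕ) : Prop :=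
  ∃ (s : Finset ℕ) (a θ : ℕ → ℝ) (P : ℕ → ℝ),
    (∀ j ∈ s, 0 < θ j ∧ θ j ≤ Real.pi / 2) ∧
    (∀ n ∈ Finset.Ico N (N + N),
      (keiperLiCoeff (n + 1) - keiperLiCoeff n) = P n + ∑ j ∈ s, a j * Real.sin (((n : ℝ) + 1 / 2) * θ j)) ∧
    (∀ n ∈ Finset.Ico N (N + N), c * Real.log N ≤ P n) ∧
    (∑ j ∈ s, ∑ k ∈ s, |a j| * |a k| * dirichletBound N (θ j - θ k) ≤ K * N * Real.log N)

/-- Block count from the block law: `#{n ∈ [N,2N) : Δ_n < 0} ≤ (K/c²) · N / log N`. -/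
theorem card_liIncr_neg_block_le {c K : ℝ} (hc : 0 < c) {N : ℕ} (hN : 2 ≤ N)
    (h : LiIncrBlockLaw c K N) :
    ((((Finset.Ico N (N + N)).filter (fun n ↦ (keiperLiCoeff (n + 1) - keiperLiCoeff n) < 0)).card : ℕ) : ℝ)
      ≤ K / c ^ 2 * (N / Real.log N) := by
  obtain ⟨s, a, θ, P, hθ, hdec, hP, hW⟩ := h
  have hN1 : (1 : ℝ) < N := by exact_mod_cast hN
  have hlog : 0 < Real.log N := Real.log_pos hN1
  have hm : 0 < c * Real.log N := mul_pos hc hlog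
  have h1 := card_neg_mul_sq_le (Δ := fun n ↦ keiperLiCoeff (n + 1) - keiperLiCoeff n) (P := P)
    (F := fun n ↦ ∑ j ∈ s, a j * Real.sin (((n : ℝ) + 1 / 2) * θ j)) hm hdec hP
  have h2 := sum_sq_le' s a θ hθ N (M := N) (by omega)
  have h3 := h1.trans (h2.trans hW)
  have e : K / c ^ 2 * (N / Real.log N) = K * N * Real.log N / (c * Real.log N) ^ 2 := by
    field_simp
  rw [e, le_div_iff₀ (by positivity)]
  exact h3

open Classical in
/-- Dyadic-to-density bookkeeping (pure): if every dyadic block `[N, 2N)` with `N ≥ N₁(ε)` contains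
`≤ ε·N` elements of `E`, then `E` has natural density zero (tree form). -/
theorem densityZero_of_dyadic {E : Set ℕ}
    (h : ∀ ε : ℝ, 0 < ε → ∃ N₁ : ℕ, ∀ N : ℕ, N₁ ≤ N →
      ((((Finset.Ico N (N + N)).filter (fun n ↦ n ∈ E)).card : ℕ) : ℝ) ≤ ε * N) :
    ∀ ε : ℝ, 0 < ε → ∀ᶠ N : ℕ in atTop,
      ((((Finset.range N).filter (fun n ↦ n ∈ E)).card : ℕ) : ℝ) ≤ ε * N := by
  intro ε hε
  obtain ⟨N₁', hN₁'⟩ := h (ε / 4) (by positivity)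
  set N₁ := max N₁' 2 with hN₁def
  have hN₁2 : 2 ≤ N₁ := le_max_right _ _
  have hblock : ∀ N : ℕ, N₁ ≤ N →
      ((((Finset.Ico N (N + N)).filter (fun n ↦ n ∈ E)).card : ℕ) : ℝ) ≤ ε / 4 * N :=
    fun N hN ↦ hN₁' N ((le_max_left _ _).trans hN)
  set L : ℕ → ℕ := fun N ↦ ((Finset.range N).filter (fun n ↦ n ∈ E)).card with hL
  have hLmono : Monotone L := by
    intro A B hAB
    exact Finset.card_le_card (Finset.filter_subset_filter _ (Finset.range_mono hAB))
  have hLle : ∀ N, L N ≤ N := fun N ↦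
    (Finset.card_le_card (Finset.filter_subset _ _)).trans (by simp)
  have hLdouble : ∀ K : ℕ, L (K + K) ≤ L K + ((Finset.Ico K (K + K)).filter (fun n ↦ n ∈ E)).card := by
    intro K
    have e : Finset.range (K + K) = Finset.range K ∪ Finset.Ico K (K + K) := by
      rw [Finset.range_eq_Ico, Finset.range_eq_Ico, Finset.Ico_union_Ico_eq_Ico (by omega) (by omega)]
    simp only [hL, e, Finset.filter_union]
    exact Finset.card_union_le _ _
  -- invariant: L N ≤ 2 N₁ + (ε/2) N, by strong induction
  have hinv : ∀ N : ℕ, (L N : ℝ) ≤ 2 * N₁ + ε / 2 * N := by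
    intro N
    induction N using Nat.strong_induction_on with
    | _ N ih =>
      rcases lt_or_ge N (2 * N₁) with hsmall | hbig
      · have := hLle N
        have h0 : (0 : ℝ) ≤ ε / 2 * N := by positivity
        have : (L N : ℝ) ≤ N := by exact_mod_cast this
        have : (N : ℝ) < 2 * N₁ := by exact_mod_cast hsmall
        linarith
      · set K := (N + 1) / 2 with hK
        have hK1 : N₁ ≤ K := by omega
        have hK2 : K < N := by omega
        have hK3 : N ≤ K + K := by omega
        have hK4 : 3 * K ≤ 2 * N := by omega
        have i1 := hLmono hK3
        have i2 := hLdouble K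
        have i3 := hblock K hK1
        have i4 := ih K hK2
        have i5 : (L N : ℝ) ≤ L K + ((Finset.Ico K (K + K)).filter (fun n ↦ n ∈ E)).card := by
          exact_mod_cast i1.trans i2
        have hK4' : (3 : ℝ) * K ≤ 2 * N := by exact_mod_cast hK4
        have hK5 : ε / 4 * (3 * (K : ℝ)) ≤ ε / 4 * (2 * N) :=
          mul_le_mul_of_nonneg_left hK4' (by positivity)
        linarith
  -- conclusion for N ≥ 4 N₁ / ε
  obtain ⟨N₂, hN₂⟩ := exists_nat_ge (4 * (N₁ : ℝ) / ε)
  refine Filter.eventually_atTop.2 ⟨N₂, fun N hN ↦ ?_⟩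
  have hN' : 4 * (N₁ : ℝ) / ε ≤ N := hN₂.trans (by exact_mod_cast hN)
  have hN'' : 2 * (N₁ : ℝ) ≤ ε / 2 * N := by
    rw [div_le_iff₀ hε] at hN'
    linarith
  have := hinv N
  simp only [hL] at this
  linarith

open Classical in
/-- **T-Li3 reduced (RH-free bookkeeping).** A block law on every dyadic block beyond `N₀` gives
density-zero exceptions to monotonicity: `#{n < N : Δ_n < 0} ≤ ε N` eventually, every `ε > 0`. -/
theorem densityZero_liIncr_neg_of_blockLaw {c K : ℝ} (hc : 0 < c) {N₀ : ℕ}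
    (h : ∀ N : ℕ, N₀ ≤ N → LiIncrBlockLaw c K N) :
    ∀ ε : ℝ, 0 < ε → ∀ᶠ N : ℕ in atTop,
      ((((Finset.range N).filter (fun n ↦ n ∈ {n : ℕ | (keiperLiCoeff (n + 1) - keiperLiCoeff n) < 0})).card : ℕ) : ℝ) ≤ ε * N := by
  classical
  refine densityZero_of_dyadic (E := {n : ℕ | (keiperLiCoeff (n + 1) - keiperLiCoeff n) < 0}) fun ε hε ↦ ?_
  -- need (K/c²) N / log N ≤ ε N, i.e. log N ≥ K/(c² ε): take N ≥ exp(K/(c² ε))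
  obtain ⟨N₃, hN₃⟩ := exists_nat_ge (Real.exp (K / (c ^ 2 * ε)))
  refine ⟨max (max N₀ 2) N₃, fun N hN ↦ ?_⟩
  have hN0 : N₀ ≤ N := ((le_max_left _ _).trans (le_max_left _ _)).trans hN
  have hN2 : 2 ≤ N := ((le_max_right _ _).trans (le_max_left _ _)).trans hN
  have hN3 : Real.exp (K / (c ^ 2 * ε)) ≤ N := hN₃.trans (by exact_mod_cast (le_max_right _ _).trans hN)
  have hN1 : (1 : ℝ) < N := by exact_mod_cast hN2
  have hlog : 0 < Real.log N := Real.log_pos hN1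
  have hlogge : K / (c ^ 2 * ε) ≤ Real.log N := by
    have := Real.log_le_log (Real.exp_pos _) hN3
    rwa [Real.log_exp] at this
  have hb := card_liIncr_neg_block_le hc hN2 (h N hN0)
  have hb' : ((((Finset.Ico N (N + N)).filter (fun n ↦ n ∈ {n : ℕ | (keiperLiCoeff (n + 1) - keiperLiCoeff n) < 0})).card : ℕ) : ℝ)
      ≤ K / c ^ 2 * (N / Real.log N) := by
    convert hb using 3; ext n; simp only [Finset.mem_filter, Set.mem_setOf_eq]
  refine hb'.trans ?_
  -- K/c² · (N/log N) ≤ ε N  ⟸  K/c² ≤ ε log N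
  have hNpos : (0 : ℝ) < N := by linarith
  have key : K / c ^ 2 ≤ ε * Real.log N := by
    rw [div_le_iff₀ (by positivity)]
    have := (div_le_iff₀ (by positivity : 0 < c ^ 2 * ε)).1 hlogge
    linarith
  calc K / c ^ 2 * (N / Real.log N) ≤ ε * Real.log N * (N / Real.log N) :=
        mul_le_mul_of_nonneg_right key (by positivity)
    _ = ε * N := by field_simp

open Classical in
/-- **T-Li3 ⟹ the almost-all-monotone equivalence.** If RH yields the block law on all large dyadic
blocks, then (with tree T-Li2 `almostAllLiMonotone_implies_rh`, p498482):
`RH ↔ (λ_n ≤ λ_{n+1} for all n ≥ 1 off a set of natural density zero)`. -/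
theorem rh_iff_almostAllLiMonotone_of_blockLaw
    (hT3 : Summit.RiemannHypothesis → ∃ c : ℝ, 0 < c ∧ ∃ K : ℝ, ∃ N₀ : ℕ,
      ∀ N : ℕ, N₀ ≤ N → LiIncrBlockLaw c K N) :
    Summit.RiemannHypothesis ↔
      ∃ E : Set ℕ, (∀ ε : ℝ, 0 < ε → ∀ᶠ N : ℕ in atTop,
          (((range N).filter (fun n => n ∈ E)).card : ℝ) ≤ ε * N) ∧
        ∀ n : ℕ, 1 ≤ n → n ∉ E → keiperLiCoeff n ≤ keiperLiCoeff (n + 1) := by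
  classical
  constructor
  · intro hRH
    obtain ⟨c, hc, K, N₀, h⟩ := hT3 hRH
    refine ⟨{n : ℕ | (keiperLiCoeff (n + 1) - keiperLiCoeff n) < 0}, ?_, fun n _ hn ↦ ?_⟩
    · intro ε hε
      have := densityZero_liIncr_neg_of_blockLaw hc h ε hε
      refine this.mono fun N hN ↦ ?_
      convert hN using 4
    · simp only [Set.mem_setOf_eq, not_lt] at hn
      linarith
  · rintro ⟨E, hE, hmono⟩
    exact LiExtremalLayer.rh_of_liIncr_nonneg_off_densityZero E hE hmono

end TLi3

end Summit.RiemannHypothesis.RiemannHypothesis.Theorems.Splittings.LiIncrBlockLaw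

end
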